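import Summits.ABC.StewartYu.PadicG3Values
import Summits.ABC.StewartYu.PadicG3SchedInst
import Summits.ABC.StewartYu.PadicG3ParVF
import Summits.ABC.StewartYu.PadicG3ParC
import Literature.Combinatorics.Enumerative.AntidiagonalTupleCard
import HarnessLib

/-!
# Cell abc-stewartyu, crux `Y07Odd` (stmt-ABC-19658): the START (Siegel) count of the frame's level-0 system in the
# PIVOT-FREE multi-index form `Icc(−X₀, X₀) ×ˢ midx M₀` — `#midx M ≤ C(M+n, n)` and the two records' (B1) BY NAME

`Summits/ABC/StewartYu/PadicG3CountMidx.lean` — cell `abc-stewartyu` (HOME `run/shared/lean/pub/abc-stewartyu/`),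
route `PadicPrimesKummerThird`, crux `Y07Odd` (stmt-ABC-19658); seat lp-1 (g3), planner g9's staffing call
2026-08-27T04:41:32Z («hB1 conjunct of both inequality stubs as landed lemmas»).  Theorems only.

Planner ruling R21-a (= p1's flag F3, print-conformal per lit g9 04:27:00Z): the level-0 Siegel system counts its
equations over the nodes `|x| ≤ X₀` times the PIVOT-FREE derivative multi-indices `S.midx M₀ = {(m₀, m) : m j₀ = 0,
m₀ + |m| ≤ M₀}` (`PadicG3Values`, as in p2's own `PadicG3Siegel.siegel_slab`/`S.eqs`), NOT over the `(n+1)`-dimensional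
jet set `tauSet`.  Here:
* **`card_midx_le`** `#midx M ≤ C(M+n, n)` — injection `(m₀, m) ↦ (m₀ + |m|, update m j₀ m₀)` into the graded tuples
  `{(d, g) : d ≤ M, ∑ g = d}` counted by stars and bars (`Literature…card_sigma_range_antidiagonalTuple`);
  `card_eqs_le` `#eqs X M ≤ (2X+1)·C(M+n, n)`;
* the schedule's level-0 order/range in closed form: `TordS Sc 0 0 ≤ Mord 0 0 + (n+1)(Sd+1)`, `NS Sc 0 0 = Xs 0`;
* the v1 count at the schedule's level-0 ORDER (which exceeds `Mord 0 0` by the `(Ŝ(n+1)+n)` transition reserve of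
  p2's `TordS`): `siegel_count₁ (hM : M′ ≤ Mord 0 0 + (n+1)(Ŝ+1))` (the v1 `siegel_count` asked `M′ ≤ Mord 0 0`; the
  slack `17 − 448/27 > 1/8 ≥ (Ŝ+2)/L` pays the reserve), and `Xs_zero_le_X`;
* **the (B1) conjuncts BY NAME**: `startCountV` (`m = 0`: `2·#eqs X₀ M₀·((p−1)p^m) ≤ (L₀V+1)·∏(2·sideV j+1)` for
  `X₀ ≤ XsV 0`, `M₀ ≤ MordV 0 0 + (n+1)(ŜG+1)`, from p1's `siegel_countV'`, p494984) and `startCount1` (`m ≥ 1` branch,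
  any `m`: `… ≤ (L₀+1)·∏(2·side j+1)` for `X₀ ≤ X`, `M₀ ≤ Mord 0 0 + (n+1)(Ŝ+1)`), both with the class factor
  `(p−1)·p^m = K` of a record with `K₀ = p − 1`; and the schedule instances `startCountV_schedV` / `startCount1_sched1`
  at `(X₀, M₀) := (NS Sc 0 0, TordS Sc 0 0)`, boxes `sideV j = ⌊LV/(2Aⱼ)⌋` / `side j = ⌊L/(2Aⱼ)⌋` (R21-d).

References: Yu. V. Nesterenko, LNM 1819 (2003), §3.5 (3.25), Prop. 3.9 (3.48); M. Waldschmidt, Acta Arith. 37 (1980) §3.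
-/

noncomputable section

open Finset Real

namespace Summit.ABC.StewartYu

/-! ### The v1 count at the schedule's level-0 order, and the level-0 range -/

namespace PadicG3Par

variable {n : ℕ} (P : PadicG3Par n)

/-- `4(Ŝ + 2) ≤ 2^Ŝ` (`Ŝ ≥ 24`). [folklore] -/
theorem four_mul_Sdepth_add_two_le : 4 * (P.Sdepth + 2) ≤ 2 ^ P.Sdepth := by
  obtain ⟨k, hk⟩ : ∃ k, P.Sdepth = k + 5 := ⟨P.Sdepth - 5, by unfold Sdepth; omega⟩
  rw [hk]
  have h1 : k < 2 ^ k := Nat.lt_two_pow_self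
  have e : 2 ^ (k + 5) = 32 * 2 ^ k := by rw [pow_add]; ring
  rw [e]; omega

/-- `(n+1)(Ŝ+2) ≤ (n+1)·L/8` (real): the transition reserve of the schedule is negligible. [folklore] -/
theorem succ_mul_Sdepth_le : ((n : ℝ) + 1) * (P.Sdepth + 2) ≤ ((n : ℝ) + 1) * P.L / 8 := by
  have h1 : ((4 * (P.Sdepth + 2) : ℕ) : ℝ) ≤ ((2 ^ P.Sdepth : ℕ) : ℝ) := by
    exact_mod_cast P.four_mul_Sdepth_add_two_le
  have h2 : ((2 * 2 ^ P.Sdepth : ℕ) : ℝ) ≤ (P.L : ℝ) := by exact_mod_cast P.two_mul_two_pow_Sdepth_le_L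
  push_cast at h1 h2
  have hn : (0 : ℝ) ≤ (n : ℝ) + 1 := by positivity
  have h3 : ((P.Sdepth : ℝ) + 2) ≤ P.L / 8 := by linarith
  calc ((n : ℝ) + 1) * (P.Sdepth + 2) ≤ ((n : ℝ) + 1) * (P.L / 8) := mul_le_mul_of_nonneg_left h3 hn
    _ = ((n : ℝ) + 1) * P.L / 8 := by ring

/-- **`C(M′+n, n) ≤ (17 e L)ⁿ` for every `M′ ≤ Mord 0 0 + (n+1)(Ŝ+1)`** (the v1 multi-index count at the
schedule's level-0 order, transition reserve included). [cite: Nesterenko2003, (3.48)] -/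
theorem choose_Mord_le₁ {M' : ℕ} (hM : M' ≤ P.Mord 0 0 + (n + 1) * (P.Sdepth + 1)) :
    (Nat.choose (M' + n) n : ℝ) ≤ (17 * P.L * Real.exp 1) ^ n := by
  refine choose_le_of_le M' (by linarith [P.one_le_L]) ?_
  have h1 : (M' : ℝ) ≤ P.Mord 0 0 + (n + 1) * (P.Sdepth + 1) := by exact_mod_cast hM
  have h2 := P.Mord_zero_zero_le'
  have h3 := P.succ_mul_Sdepth_le
  have hL : (0 : ℝ) ≤ P.L := by positivity
  have h0 : (0 : ℝ) ≤ n := by positivity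
  have h4 : (n : ℝ) ≤ ((n : ℝ) + 1) * 1 := by linarith
  nlinarith

/-- **(B1) for v1 at the schedule's order**: `2 (2X+1) · C(M′+n, n) · K ≤ (L₀+1) · ∏ (2 side j + 1)` for every
`M′ ≤ Mord 0 0 + (n+1)(Ŝ+1)`. [cite: Nesterenko2003, Prop 3.9 (3.48)] -/
theorem siegel_count_real₁ {M' : ℕ} (hM : M' ≤ P.Mord 0 0 + (n + 1) * (P.Sdepth + 1)) :
    2 * (2 * (P.X : ℝ) + 1) * (Nat.choose (M' + n) n : ℝ) * P.K ≤
      ((P.L₀ : ℝ) + 1) * ∏ j, (2 * (P.side j : ℝ) + 1) := by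
  have hC := P.choose_Mord_le₁ hM
  have hprod := P.prod_side_ge
  have hL₀ := P.L₀_ge
  have hX : (1 : ℝ) ≤ P.X := by exact_mod_cast P.one_le_X
  have hK := P.K_pos
  have hΩ := P.Ω_pos
  have hL : (0 : ℝ) ≤ P.L := by linarith [P.one_le_L]
  have he : (0 : ℝ) ≤ Real.exp 1 := (Real.exp_pos 1).le
  -- right side ≥ 6 X K (24 e L)ⁿ
  have hR : 6 * P.X * P.K * (24 * P.L * Real.exp 1) ^ n ≤
      ((P.L₀ : ℝ) + 1) * ∏ j, (2 * (P.side j : ℝ) + 1) := by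
    have e2 : Cb * (3 / 4) * P.L = 24 * P.L * Real.exp 1 := by unfold Cb cM; push_cast; ring
    have e : 6 * P.X * Cb ^ n * P.Ω * P.K * ((3 / 4 : ℝ) ^ n * ((P.L : ℝ) ^ n / P.Ω)) =
        6 * P.X * P.K * (24 * P.L * Real.exp 1) ^ n := by
      rw [← e2, mul_pow, mul_pow]
      field_simp
    rw [← e]
    have h0 : 0 ≤ 6 * P.X * Cb ^ n * P.Ω * P.K := by
      have := Cb_pos; positivity
    calc 6 * P.X * Cb ^ n * P.Ω * P.K * ((3 / 4 : ℝ) ^ n * ((P.L : ℝ) ^ n / P.Ω))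
        ≤ (P.L₀ : ℝ) * ∏ j, (2 * (P.side j : ℝ) + 1) :=
          mul_le_mul hL₀ hprod (by positivity) (by positivity)
      _ ≤ ((P.L₀ : ℝ) + 1) * ∏ j, (2 * (P.side j : ℝ) + 1) := by
          have : 0 ≤ ∏ j, (2 * (P.side j : ℝ) + 1) := prod_nonneg fun j _ => by positivity
          nlinarith
  have h17 : (17 * P.L * Real.exp 1) ^ n ≤ (24 * P.L * Real.exp 1) ^ n :=
    pow_le_pow_left₀ (by positivity) (by nlinarith) n
  have hpow : 0 ≤ (17 * P.L * Real.exp 1) ^ n := by positivity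
  calc 2 * (2 * (P.X : ℝ) + 1) * (Nat.choose (M' + n) n : ℝ) * P.K
      ≤ 2 * (2 * (P.X : ℝ) + 1) * (17 * P.L * Real.exp 1) ^ n * P.K := by gcongr
    _ ≤ 6 * P.X * P.K * (17 * P.L * Real.exp 1) ^ n := by nlinarith [mul_nonneg hpow hK.le]
    _ ≤ 6 * P.X * P.K * (24 * P.L * Real.exp 1) ^ n := by gcongr
    _ ≤ _ := hR

/-- (B1) for v1 at the schedule's order, natural numbers. [cite: Nesterenko2003, Prop 3.9 (3.48)] -/
theorem siegel_count₁ {M' : ℕ} (hM : M' ≤ P.Mord 0 0 + (n + 1) * (P.Sdepth + 1)) :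
    2 * (2 * P.X + 1) * Nat.choose (M' + n) n * P.K ≤ (P.L₀ + 1) * ∏ j, (2 * P.side j + 1) := by
  have h := P.siegel_count_real₁ hM
  exact_mod_cast h

/-- The v1 level-0 range is below `X`: `X_0 = 4XL/(8L+1) ≤ X`. [folklore] -/
theorem Xs_zero_le_X : P.Xs 0 ≤ P.X := by
  unfold Xs
  rw [P.T_zero]
  exact Nat.div_le_of_le_mul (by nlinarith [Nat.zero_le (P.X * P.L), Nat.zero_le P.X])

/-- The class factor of a record with `K₀ = p − 1`: `(p − 1)·p^m = K`. [folklore] -/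
theorem class_factor_eq_K {p : ℕ} (hPp : P.p = p) (hK₀ : P.K₀ = p - 1) : (p - 1) * p ^ P.m = P.K := by
  unfold K; rw [hK₀, hPp, mul_comm]

end PadicG3Par

/-! ### `#midx M ≤ C(M+n, n)` and the START counts by name -/

namespace G3Setup

variable {p : ℕ} [Fact p.Prime] (S : G3Setup p)

/-- Stars and bars with a degree cap, for any positive number of variables:
`#{(d, g) : d < α, g : Fin n → ℕ, ∑ g = d} = C(α + n − 1, n)`. [folklore] -/
theorem card_sigma_range_antidiagonalTuple_of_pos {n : ℕ} (hn : 1 ≤ n) (α : ℕ) :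
    ((range α).sigma fun d ↦ Finset.Nat.antidiagonalTuple n d).card = (α + n - 1).choose n := by
  obtain ⟨k, rfl⟩ : ∃ k, n = k + 1 := ⟨n - 1, by omega⟩
  have h := Literature.Combinatorics.Enumerative.card_sigma_range_antidiagonalTuple k α
  have e : α + (k + 1) - 1 = α + k := by omega
  rw [e, h]

/-- **`#midx M ≤ C(M+n, n)`**: the pivot-free multi-indices `(m₀, m)`, `m j₀ = 0`, `m₀ + |m| ≤ M` inject into the
graded tuples `(d, g)`, `d ≤ M`, `∑ g = d` by `(m₀, m) ↦ (m₀ + |m|, update m j₀ m₀)`. [cite: Nesterenko2003, (3.48)] -/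
theorem card_midx_le (M : ℕ) : (S.midx M).card ≤ (M + S.n).choose S.n := by
  classical
  have hn : 1 ≤ S.n := Fin.pos S.j₀
  have hT : ((range (M + 1)).sigma fun d ↦ Finset.Nat.antidiagonalTuple S.n d).card = (M + S.n).choose S.n := by
    have e : M + 1 + S.n - 1 = M + S.n := by omega
    rw [card_sigma_range_antidiagonalTuple_of_pos hn, e]
  rw [← hT]
  refine Finset.card_le_card_of_injOn
    (fun m : ℕ × (Fin S.n → ℕ) => (⟨m.1 + ∑ k, m.2 k, Function.update m.2 S.j₀ m.1⟩ : Σ _ : ℕ, (Fin S.n → ℕ)))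
    (fun m hm => ?_) (fun m hm m' hm' heq => ?_)
  · -- lands in the graded tuples
    rw [Finset.mem_coe, S.mem_midx] at hm
    rw [Finset.mem_coe, Finset.mem_sigma, Finset.mem_range, Finset.Nat.mem_antidiagonalTuple]
    dsimp only
    refine ⟨by omega, ?_⟩
    rw [Finset.sum_update_of_mem (Finset.mem_univ _), Finset.sdiff_singleton_eq_erase,
      Finset.sum_erase _ hm.1]
  · -- injective on `midx`
    rw [Finset.mem_coe, S.mem_midx] at hm hm'
    dsimp only at heq
    simp only [Sigma.mk.injEq, heq_eq_eq] at heq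
    obtain ⟨_, h2⟩ := heq
    have h3 : m.1 = m'.1 := by
      have := congrFun h2 S.j₀
      simpa using this
    have h4 : m.2 = m'.2 := by
      funext k
      by_cases hk : k = S.j₀
      · rw [hk, hm.1, hm'.1]
      · have := congrFun h2 k
        simpa [Function.update_apply, hk] using this
    exact Prod.ext h3 h4

/-- `#eqs X M ≤ (2X+1)·C(M+n, n)`. [cite: Nesterenko2003, (3.48)] -/
theorem card_eqs_le (X M : ℕ) : (S.eqs X M).card ≤ (2 * X + 1) * (M + S.n).choose S.n := by
  unfold eqs
  rw [Finset.card_product, Int.card_Icc]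
  have h1 : ((X : ℤ) + 1 - -(X : ℤ)).toNat = 2 * X + 1 := by omega
  rw [h1]
  exact Nat.mul_le_mul_left _ (S.card_midx_le M)

/-- The schedule's level-0 order: `TordS Sc 0 0 = Mord 0 0 + Sd·(n+1) + n ≤ Mord 0 0 + (n+1)(Sd+1)`. [folklore] -/
theorem TordS_zero_le (Sc : G3Sched S.n) : S.TordS Sc 0 0 ≤ Sc.Mord 0 0 + (S.n + 1) * (Sc.Sd + 1) := by
  unfold TordS remS
  simp only [Nat.sub_zero]
  nlinarith [Nat.zero_le Sc.Sd, Nat.zero_le S.n]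

/-- The schedule's level-0 range: `NS Sc 0 0 = Xs 0`. [folklore] -/
theorem NS_zero_zero (Sc : G3Sched S.n) : S.NS Sc 0 0 = Sc.Xs 0 := by
  unfold NS; rw [pow_zero, one_mul]

variable (P : PadicG3Par S.n)

/-- **(B1) BY NAME, branch `m = 0` (v2 family `PadicG3ParV`)**: for a record with `P.p = p`, `K₀ = p − 1` and every
`X₀ ≤ XsV 0`, `M₀ ≤ MordV 0 0 + (n+1)(ŜG+1)`:
`2·#eqs X₀ M₀·((p−1)·p^m) ≤ (L₀V + 1)·∏ (2·sideV j + 1)` (box `sideV j = ⌊LV/(2Aⱼ)⌋`). [cite: Nesterenko2003, Prop 3.9 (3.48)] -/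
theorem startCountV (hPp : P.p = p) (hK₀ : P.K₀ = p - 1) {X₀ M₀ : ℕ} (hX : X₀ ≤ P.XsV 0)
    (hM : M₀ ≤ P.MordV 0 0 + (S.n + 1) * (P.SdG + 1)) :
    2 * (S.eqs X₀ M₀).card * ((p - 1) * p ^ P.m) ≤ (P.L0V + 1) * ∏ j, (2 * P.sideV j + 1) := by
  have h1 := S.card_eqs_le X₀ M₀
  have h2 := P.siegel_countV' hM
  rw [P.class_factor_eq_K hPp hK₀]
  calc 2 * (S.eqs X₀ M₀).card * P.K ≤ 2 * ((2 * X₀ + 1) * (M₀ + S.n).choose S.n) * P.K := by gcongr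
    _ ≤ 2 * ((2 * P.XsV 0 + 1) * (M₀ + S.n).choose S.n) * P.K := by gcongr
    _ = 2 * (2 * P.XsV 0 + 1) * Nat.choose (M₀ + S.n) S.n * P.K := by ring
    _ ≤ _ := h2

/-- **(B1) BY NAME, branch `m ≥ 1` (v1 family `PadicG3Par`; valid for any `m`)**: for a record with `P.p = p`,
`K₀ = p − 1` and every `X₀ ≤ X`, `M₀ ≤ Mord 0 0 + (n+1)(Ŝ+1)`:
`2·#eqs X₀ M₀·((p−1)·p^m) ≤ (L₀ + 1)·∏ (2·side j + 1)` (box `side j = ⌊L/(2Aⱼ)⌋`). [cite: Nesterenko2003, Prop 3.9 (3.48)] -/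
theorem startCount1 (hPp : P.p = p) (hK₀ : P.K₀ = p - 1) {X₀ M₀ : ℕ} (hX : X₀ ≤ P.X)
    (hM : M₀ ≤ P.Mord 0 0 + (S.n + 1) * (P.Sdepth + 1)) :
    2 * (S.eqs X₀ M₀).card * ((p - 1) * p ^ P.m) ≤ (P.L₀ + 1) * ∏ j, (2 * P.side j + 1) := by
  have h1 := S.card_eqs_le X₀ M₀
  have h2 := P.siegel_count₁ hM
  rw [P.class_factor_eq_K hPp hK₀]
  calc 2 * (S.eqs X₀ M₀).card * P.K ≤ 2 * ((2 * X₀ + 1) * (M₀ + S.n).choose S.n) * P.K := by gcongr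
    _ ≤ 2 * ((2 * P.X + 1) * (M₀ + S.n).choose S.n) * P.K := by gcongr
    _ = 2 * (2 * P.X + 1) * Nat.choose (M₀ + S.n) S.n * P.K := by ring
    _ ≤ _ := h2

/-- **(B1) at an abstract schedule's level-0 system, v2 instance**: with `Sc.Xs 0 ≤ XsV 0`, `Sc.Mord 0 0 ≤ MordV 0 0`,
`Sc.Sd ≤ ŜG`, `Sc.m = P.m` (all `rfl`/`le_rfl` for p2's `P.schedV`):
`2·#eqs (NS Sc 0 0) (TordS Sc 0 0)·((p−1)·p^{Sc.m}) ≤ (L₀V+1)·∏(2·sideV j+1)`. [cite: Nesterenko2003, Prop 3.9 (3.48)] -/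
theorem startCountV_sched (Sc : G3Sched S.n) (hPp : P.p = p) (hK₀ : P.K₀ = p - 1) (hm : Sc.m = P.m)
    (hXs : Sc.Xs 0 ≤ P.XsV 0) (hMord : Sc.Mord 0 0 ≤ P.MordV 0 0) (hSd : Sc.Sd ≤ P.SdG) :
    2 * (S.eqs (S.NS Sc 0 0) (S.TordS Sc 0 0)).card * ((p - 1) * p ^ Sc.m) ≤
      (P.L0V + 1) * ∏ j, (2 * P.sideV j + 1) := by
  rw [hm, S.NS_zero_zero]
  refine S.startCountV P hPp hK₀ hXs ?_
  have h := S.TordS_zero_le Sc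
  have h2 : (S.n + 1) * (Sc.Sd + 1) ≤ (S.n + 1) * (P.SdG + 1) := Nat.mul_le_mul_left _ (by omega)
  omega

/-- **(B1) at an abstract schedule's level-0 system, v1 instance**: with `Sc.Xs 0 ≤ X`, `Sc.Mord 0 0 ≤ Mord 0 0`,
`Sc.Sd ≤ Ŝ`, `Sc.m = P.m` (for p2's `P.sched1`: `Xs_zero_le_X`, `le_rfl`, `le_rfl`, `rfl`):
`2·#eqs (NS Sc 0 0) (TordS Sc 0 0)·((p−1)·p^{Sc.m}) ≤ (L₀+1)·∏(2·side j+1)`. [cite: Nesterenko2003, Prop 3.9 (3.48)] -/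
theorem startCount1_sched (Sc : G3Sched S.n) (hPp : P.p = p) (hK₀ : P.K₀ = p - 1) (hm : Sc.m = P.m)
    (hXs : Sc.Xs 0 ≤ P.X) (hMord : Sc.Mord 0 0 ≤ P.Mord 0 0) (hSd : Sc.Sd ≤ P.Sdepth) :
    2 * (S.eqs (S.NS Sc 0 0) (S.TordS Sc 0 0)).card * ((p - 1) * p ^ Sc.m) ≤
      (P.L₀ + 1) * ∏ j, (2 * P.side j + 1) := by
  rw [hm, S.NS_zero_zero]
  refine S.startCount1 P hPp hK₀ hXs ?_
  have h := S.TordS_zero_le Sc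
  have h2 : (S.n + 1) * (Sc.Sd + 1) ≤ (S.n + 1) * (P.Sdepth + 1) := Nat.mul_le_mul_left _ (by omega)
  omega

/-- **(B1) for p2's `m = 0` schedule `P.schedV`** (level-0 system `eqs (NS schedV 0 0) (TordS schedV 0 0)`, box
`sideV j = ⌊LV/(2Aⱼ)⌋`, class factor `(p−1)·p^m`). [cite: Nesterenko2003, Prop 3.9 (3.48)] -/
theorem startCountV_schedV (hPp : P.p = p) (hK₀ : P.K₀ = p - 1) :
    2 * (S.eqs (S.NS P.schedV 0 0) (S.TordS P.schedV 0 0)).card * ((p - 1) * p ^ P.schedV.m) ≤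
      (P.L0V + 1) * ∏ j, (2 * P.sideV j + 1) :=
  S.startCountV_sched P P.schedV hPp hK₀ rfl le_rfl le_rfl le_rfl

/-- **(B1) for p2's `m ≥ 1` schedule `P.sched1`** (level-0 system `eqs (NS sched1 0 0) (TordS sched1 0 0)`, box
`side j = ⌊L/(2Aⱼ)⌋`, class factor `(p−1)·p^m`; no hypothesis on `m`). [cite: Nesterenko2003, Prop 3.9 (3.48)] -/
theorem startCount1_sched1 (hPp : P.p = p) (hK₀ : P.K₀ = p - 1) :
    2 * (S.eqs (S.NS P.sched1 0 0) (S.TordS P.sched1 0 0)).card * ((p - 1) * p ^ P.sched1.m) ≤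
      (P.L₀ + 1) * ∏ j, (2 * P.side j + 1) :=
  S.startCount1_sched P P.sched1 hPp hK₀ rfl P.Xs_zero_le_X le_rfl le_rfl

end G3Setup

end Summit.ABC.StewartYu

end
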